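import Summits.HodgeConjecture.HodgeConjecture.Theses.NikulinTwinTransport
import Literature.AlgebraicGeometry.Surfaces.K3HodgeTypesHolds
import Literature.AlgebraicGeometry.Surfaces.K3MarkingProofs

/-!
# `K3PeriodSurjective` (stmt-HodgeConjecture-15154) · Negative · positivity and isotropy are load-bearing

Negative-side knowledge for the crux `NikulinTwinTransport.K3PeriodSurjective` (surjectivity of the
period map for PROJECTIVE K3 surfaces, verbatim the named Literature fact
`Huybrechts_K3_periodSurjective_projective` with `IsK3Surface` unfolded; Huybrechts, *Lectures on K3
Surfaces*, Ch. 6 Thm. 3.1 / Rem. 3.3, Ch. 7 Thm. 4.1, projectivity criterion Ch. 1 §3), extracted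
from the standing disprover's work file `Cruxes/K3PeriodSurjective/Disproof.lean`
(refuter-cdisprove-stmt-HodgeConjecture-15154-0, cycle 1, 2026-08-16) so that provers and planners
can import it. The crux is a faithfully rendered theorem (no kill); what is proved here is that its
hypotheses on the period vector `x` cannot be dropped or cheaply weakened, using only PROVED K3 facts
of the tree (`IsK3Surface.exists_isOfHodgeType_twoZero_ne_zero`, `IsK3Surface.cupProduct_twoZero_self`,
`IsK3Surface.cupProduct_conjClass_self_ne_zero`, fed with the discharges
`Voisin2002_closedForm_top_zero_not_exact_holds`, `hodgePQ_independent_of_hodgeModel_holds`,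
`exists_deRhamIsoFamily_holds` — the latter inlined, it is also the tree's
`HeckePrymWeil.multiplicativeDeRham_complexModel`):

* `k3PeriodSurjective_false_without_positivity`  — drop `0 < re (x̄.x)`: `x = 0` kills it (a K3
  surface has a non-zero `(2,0)`-class);
* `k3PeriodSurjective_false_without_positivity'` — positivity weakened to `x ≠ 0` still fails, at
  the real isotropic lattice vector `x = e₁` (Hodge–Riemann `σ̄ ∪ σ ≠ 0` against `σ̄ = σ`,
  `σ ∪ σ = (x.x) p = 0`);
* `k3PeriodSurjective_false_without_isotropy` — drop `(x.x) = 0`: `x = e₁ + f₁` kills it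
  (`σ ∪ σ = 0` by type forces `p = 0`, contradicting Hodge–Riemann).
The projectivity hypothesis is treated in the sibling file `NonProjectivePeriod.lean` (an explicit
period vector with negative semi-definite Néron–Severi lattice). Also recorded: the negatively used
span clause (`∀ σ` of type `(2,0)`, `σ ∈ ℂ φ⁻¹x`) may be read in any one Hodge model by the tree's
THEOREM `hodgePQ_independent_of_hodgeModel_holds` (`span_clause_iff_of_model`) — the
exotic-Hodge-model attack on the crux is closed — and the marking bookkeeping (`cup_symm_symm`,
`conjClass_symm`: a marking is REAL, `conj (φ⁻¹y) = φ⁻¹ȳ`, `cup_conj_symm_self`).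

## References

* [Huybrechts2016K3] D. Huybrechts, Lectures on K3 Surfaces (2016), Ch. 1 §3 and Prop. 3.5; Ch. 3
  Def. 2.3; Ch. 6 §1.1, Prop. 1.2, Rem. 3.3; Ch. 14 §0.3.
* [VoisinHodgeI2002] C. Voisin, Hodge Theory and Complex Algebraic Geometry I (2002), Cor. 6.12,
  Cor. 7.6, Lemma 7.30, §7.3.2.
-/

noncomputable section

open scoped BigOperators ComplexConjugate Manifold ContDiff
open Literature.AlgebraicGeometry Literature.AlgebraicGeometry.Surfaces
  Literature.AlgebraicGeometry.HodgeTheory Literature.AlgebraicTopology.SingularHomology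
open Summit.HodgeConjecture.HodgeConjecture.Theses.NikulinTwinTransport

namespace Summit.HodgeConjecture.HodgeConjecture.Theorems.K3PeriodSurjective.Negative

/-! ### The crux, reread -/

/-- `Realised[x]`: the conclusion of the crux at the period vector `x`, VERBATIM — a projective K3
surface `S` (unfolded `IsK3Surface`), a marking `φ`, an integral generator `p` of `H⁴`, integral
classes `↔ ℤ²²`, cup product `= k3Form • p`, `φ⁻¹ x` of type `(2,0)` spanning the `(2,0)`-classes.
Local notation only. -/
local notation3 (prettyPrint := false) "Realised[" x "]" =>
  ∃ (S : Motives.SchemeOver ℂ) (_ : (Motives.IsSmoothProjective 2 S ∧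
      Subsingleton (Motives.structureSheafCohomology S.left 1) ∧
      ∃ (A : HodgeModel 2 S) (η : Literature.Geometry.Kaehler.MForm 𝓘(ℝ, A.model) A.carrier ℂ 2),
        Literature.Geometry.Kaehler.IsHolomorphicInCharts η ∧ ∀ z, η z ≠ 0))
    (φ : complexBetti S (2 * 1) ≃ₗ[ℂ] (K3Index → ℂ)) (p : complexBetti S (2 * 2)),
    IsIntegralClass p ∧
    (∀ q : complexBetti S (2 * 2), IsIntegralClass q → ∃ n : ℤ, q = n • p) ∧
    (∀ c : complexBetti S (2 * 1), IsIntegralClass c ↔ ∃ v : K3Index → ℤ, φ c = fun i => (v i : ℂ)) ∧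
    (∀ a b : complexBetti S (2 * 1),
      cupProduct (rfl : 2 * 1 + 2 * 1 = 2 * 2) a b = k3Form (φ a) (φ b) • p) ∧
    IsOfHodgeType 2 S (2 * 1) 2 0 (φ.symm x) ∧
    (∀ σ : complexBetti S (2 * 1), IsOfHodgeType 2 S (2 * 1) 2 0 σ → ∃ t : ℂ, σ = t • φ.symm x)

/-- `PosVec[x]`: the projectivity hypothesis of the crux at `x` (a lattice vector orthogonal to `x`
of positive square). Local notation only. -/
local notation3 (prettyPrint := false) "PosVec[" x "]" =>
  ∃ v : K3Index → ℤ, k3Form (fun i => (v i : ℂ)) x = 0 ∧ 0 < ∑ i, ∑ j, v i * k3Gram i j * v j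

/-- The crux reread through `Realised[·]`/`PosVec[·]` (definitional; it is also `Iff.rfl` with the
named fact `Huybrechts_K3_periodSurjective_projective`). [cite: Huybrechts2016K3, Ch. 6 Rem. 3.3] -/
theorem k3PeriodSurjective_iff :
    K3PeriodSurjective ↔
      ∀ x : K3Index → ℂ, k3Form x x = 0 → 0 < (k3Form (star x) x).re → PosVec[x] → Realised[x] :=
  Iff.rfl

/-- The negatively used span clause of the crux may be read in ANY single Hodge model `A` of the
realising surface, by the tree's theorem `hodgePQ_independent_of_hodgeModel_holds` (all Hodge
models of a smooth projective variety cut out the same `H^{p,q}`): exotic Hodge models cannot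
enlarge `H^{2,0}`. [cite: VoisinHodgeI2002, §7.3.2] -/
theorem span_clause_iff_of_model {S : Motives.SchemeOver ℂ} (hS : Motives.IsSmoothProjective 2 S)
    (A : HodgeModel 2 S) (σ₀ : complexBetti S (2 * 1)) :
    (∀ σ : complexBetti S (2 * 1), IsOfHodgeType 2 S (2 * 1) 2 0 σ → ∃ t : ℂ, σ = t • σ₀) ↔
      ∀ σ : complexBetti S (2 * 1), A.pullback (2 * 1) σ ∈ A.hodgePQ (2 * 1) 2 0 →
        ∃ t : ℂ, σ = t • σ₀ := by
  refine ⟨fun h σ hσ => h σ ⟨A, hσ⟩, fun h σ hσ => h σ ?_⟩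
  exact (hodgePQ_independent_of_hodgeModel_holds.isOfHodgeType_iff hS A).1 hσ

/-! ### Witness vectors (coordinates on `Λ = E₈(−1) ⊕ E₈(−1) ⊕ U₁ ⊕ U₂ ⊕ U₃`, `Uₖ = ⟨eₖ, fₖ⟩`) -/

/-- `e₁`: a non-zero REAL ISOTROPIC vector. Local notation only. -/
local notation3 (prettyPrint := false) "perE₁" => (Sum.elim 0 (Sum.elim ![1, 0] 0) : K3Index → ℂ)

/-- `e₁ ∈ Λ`. Local notation only. -/
local notation3 (prettyPrint := false) "latE₁" => (Sum.elim 0 (Sum.elim ![1, 0] 0) : K3Index → ℤ)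

/-- `e₁ + f₁`: a real vector of square `2`. Local notation only. -/
local notation3 (prettyPrint := false) "perE₁F₁" =>
  (Sum.elim 0 (Sum.elim ![1, 1] 0) : K3Index → ℂ)

/-- `e₃ + f₃ ∈ Λ`: square `2`, orthogonal to `U₁ ⊕ U₂`. Local notation only. -/
local notation3 (prettyPrint := false) "latE₃F₃" =>
  (Sum.elim 0 (Sum.elim 0 (Sum.elim 0 ![1, 1])) : K3Index → ℤ)

/-- `e₃ ∈ Λ`: isotropic, non-zero. Local notation only. -/
local notation3 (prettyPrint := false) "latE₃" =>
  (Sum.elim 0 (Sum.elim 0 (Sum.elim 0 ![1, 0])) : K3Index → ℤ)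

/-- **The non-projective period vector** `perNP = (e₁ + f₁ + √2 e₃) + i (e₂ + f₂ + √2 e₃)`.
Local notation only. -/
local notation3 (prettyPrint := false) "perNP" =>
  (Sum.elim 0 (Sum.elim ![1, 1] (Sum.elim ![Complex.I, Complex.I]
    ![((Real.sqrt 2 : ℝ) : ℂ) * (1 + Complex.I), 0])) : K3Index → ℂ)

/-- `(e₁.e₁) = 0`. [cite: Huybrechts2016K3, Ch. 14 §0.3] -/
theorem perE₁_isotropic : k3Form perE₁ perE₁ = 0 := by
  simp [k3Form, k3Gram, hyperbolicPlaneGram, Fintype.sum_sum_type, Fin.sum_univ_two]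

/-- `e₁ ≠ 0`. [folklore] -/
theorem perE₁_ne_zero : perE₁ ≠ 0 := by
  intro h
  have := congrFun h (Sum.inr (Sum.inl 0))
  simp at this

/-- `e₁` is a lattice vector. [folklore] -/
theorem perE₁_eq_intCast : perE₁ = fun i => (latE₁ i : ℂ) := by
  funext i
  rcases i with (i | i) | (i | (i | i)) <;> (try fin_cases i) <;> simp

/-- `(e₃ + f₃).e₁ = 0`. [cite: Huybrechts2016K3, Ch. 14 §0.3] -/
theorem latE₃F₃_orth_perE₁ : k3Form (fun i => (latE₃F₃ i : ℂ)) perE₁ = 0 := by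
  simp [k3Form, k3Gram, hyperbolicPlaneGram, Fintype.sum_sum_type, Fin.sum_univ_two]

/-- `(e₃ + f₃)² = 2 > 0`. [cite: Huybrechts2016K3, Ch. 14 §0.3] -/
theorem latE₃F₃_pos : 0 < ∑ i, ∑ j, latE₃F₃ i * k3Gram i j * latE₃F₃ j := by
  simp [k3Gram, hyperbolicPlaneGram, Fintype.sum_sum_type, Fin.sum_univ_two]

/-- `(e₁ + f₁)² = 2`. [cite: Huybrechts2016K3, Ch. 14 §0.3] -/
theorem perE₁F₁_sq : k3Form perE₁F₁ perE₁F₁ = 2 := by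
  simp [k3Form, k3Gram, hyperbolicPlaneGram, Fintype.sum_sum_type, Fin.sum_univ_two]
  norm_num

/-- `re ((e₁ + f₁)‾.(e₁ + f₁)) = 2 > 0`. [cite: Huybrechts2016K3, Ch. 6 §1.1] -/
theorem perE₁F₁_pos : 0 < (k3Form (star perE₁F₁) perE₁F₁).re := by
  simp [k3Form, k3Gram, hyperbolicPlaneGram, Fintype.sum_sum_type, Fin.sum_univ_two]

/-- `e₁ + f₁ ≠ 0`. [folklore] -/
theorem perE₁F₁_ne_zero : perE₁F₁ ≠ 0 := by
  intro h
  have := congrFun h (Sum.inr (Sum.inl 0))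
  simp at this

/-- `(e₃ + f₃).(e₁ + f₁) = 0`. [cite: Huybrechts2016K3, Ch. 14 §0.3] -/
theorem latE₃F₃_orth_perE₁F₁ : k3Form (fun i => (latE₃F₃ i : ℂ)) perE₁F₁ = 0 := by
  simp [k3Form, k3Gram, hyperbolicPlaneGram, Fintype.sum_sum_type, Fin.sum_univ_two]

/-! ### Bookkeeping on a marking datum `(φ, p)` -/

section Marking

variable {S : Motives.SchemeOver ℂ} {φ : complexBetti S (2 * 1) ≃ₗ[ℂ] (K3Index → ℂ)}
  {p : complexBetti S (2 * 2)}

/-- Cup products of marked classes: `φ⁻¹y ∪ φ⁻¹z = (y.z) p`. [cite: Huybrechts2016K3, Ch. 1 Prop. 3.5] -/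
theorem cup_symm_symm
    (hcup : ∀ a b : complexBetti S (2 * 1),
      cupProduct (rfl : 2 * 1 + 2 * 1 = 2 * 2) a b = k3Form (φ a) (φ b) • p)
    (y z : K3Index → ℂ) :
    cupProduct (rfl : 2 * 1 + 2 * 1 = 2 * 2) (φ.symm y) (φ.symm z) = k3Form y z • p := by
  rw [hcup, LinearEquiv.apply_symm_apply, LinearEquiv.apply_symm_apply]

/-- Lattice vectors give integral classes under a marking. [cite: Huybrechts2016K3, Ch. 1 Prop. 3.5] -/
theorem isIntegralClass_symm_intCast
    (hint : ∀ c : complexBetti S (2 * 1), IsIntegralClass c ↔ ∃ v : K3Index → ℤ, φ c = fun i => (v i : ℂ))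
    (w : K3Index → ℤ) : IsIntegralClass (φ.symm fun i => (w i : ℂ)) :=
  (hint _).2 ⟨w, LinearEquiv.apply_symm_apply _ _⟩

/-- **A marking is real**: complex conjugation of classes is coordinatewise conjugation,
`conj (φ⁻¹ y) = φ⁻¹ ȳ` (the standard basis vectors are integral classes, fixed by conjugation, and
`conjClass` is conjugate-linear). [cite: VoisinHodgeI2002, Cor. 6.12] -/
theorem conjClass_symm
    (hint : ∀ c : complexBetti S (2 * 1), IsIntegralClass c ↔ ∃ v : K3Index → ℤ, φ c = fun i => (v i : ℂ))
    (y : K3Index → ℂ) :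
    conjClass (Motives.ComplexPoints S) (2 * 1) (φ.symm y) = φ.symm (star y) := by
  classical
  have hb : ∀ i : K3Index, IsRationalClass (φ.symm fun j => if i = j then (1 : ℂ) else 0) := by
    intro i
    refine ((hint _).2 ⟨fun j => if i = j then 1 else 0, ?_⟩).isRationalClass
    rw [LinearEquiv.apply_symm_apply]
    funext j
    by_cases h : i = j <;> simp [h]
  have hy : y = ∑ i, y i • fun j => if i = j then (1 : ℂ) else 0 := pi_eq_sum_univ y
  have hsy : star y = ∑ i, (star y) i • fun j => if i = j then (1 : ℂ) else 0 := pi_eq_sum_univ (star y)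
  conv_lhs => rw [hy]
  rw [hsy, map_sum, map_sum, ← conjClassEquiv_apply, map_sum]
  refine Finset.sum_congr rfl fun i _ => ?_
  rw [conjClassEquiv_apply, map_smul, map_smul, conjClass_smul, (hb i).conjClass_eq, Pi.star_apply,
    Complex.star_def]

/-- Hodge–Riemann read through a marking: `conj(φ⁻¹x) ∪ φ⁻¹x = (x̄.x) p`. [cite: Huybrechts2016K3, Ch. 6 Prop. 1.2 (ii)] -/
theorem cup_conj_symm_self
    (hint : ∀ c : complexBetti S (2 * 1), IsIntegralClass c ↔ ∃ v : K3Index → ℤ, φ c = fun i => (v i : ℂ))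
    (hcup : ∀ a b : complexBetti S (2 * 1),
      cupProduct (rfl : 2 * 1 + 2 * 1 = 2 * 2) a b = k3Form (φ a) (φ b) • p)
    (x : K3Index → ℂ) :
    cupProduct (rfl : 2 * 1 + 2 * 1 = 2 * 2) (conjClass (Motives.ComplexPoints S) (2 * 1) (φ.symm x))
      (φ.symm x) = k3Form (star x) x • p := by
  rw [conjClass_symm hint, cup_symm_symm hcup]

/-- A marked class is non-zero if its coordinate vector is. [folklore] -/
theorem symm_ne_zero {x : K3Index → ℂ} (hx : x ≠ 0) : φ.symm x ≠ 0 := by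
  intro h
  exact hx (by simpa using congrArg φ h)

end Marking

/-! ### Positivity and isotropy are load-bearing -/

/-- **Positivity is load-bearing**: the crux WITHOUT `0 < re (x̄.x)` is false — at `x = 0`
(`v = e₃ + f₃`) the realising K3 would have all its `(2,0)`-classes equal to `t • φ⁻¹ 0 = 0`, but a
K3 surface has a non-zero `(2,0)`-class (`IsK3Surface.exists_isOfHodgeType_twoZero_ne_zero`).
[cite: Huybrechts2016K3, Ch. 3 Def. 2.3 and Ch. 6 §1.1] -/
theorem k3PeriodSurjective_false_without_positivity :
    ¬ ∀ x : K3Index → ℂ, k3Form x x = 0 → PosVec[x] → Realised[x] := by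
  intro h
  obtain ⟨S, hS, φ, p, -, -, -, -, -, hspan⟩ :=
    h 0 (k3Form_zero_left 0) ⟨latE₃F₃, k3Form_zero_right _, latE₃F₃_pos⟩
  obtain ⟨σ, hσ0, hσ⟩ := IsK3Surface.exists_isOfHodgeType_twoZero_ne_zero
    (fun E _ _ _ M _ _ => Voisin2002_closedForm_top_zero_not_exact_holds E M) (S := S) hS
  obtain ⟨t, ht⟩ := hspan σ hσ
  exact hσ0 (by rw [ht, map_zero, smul_zero])

/-- **Positivity cannot be weakened to `x ≠ 0`**: at the non-zero real isotropic lattice vector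
`x = e₁` (`v = e₃ + f₃`) the conclusion fails — `σ = φ⁻¹ e₁` would be a non-zero `(2,0)`-class,
integral hence real (`σ̄ = σ`), with `σ̄ ∪ σ = (e₁.e₁) p = 0`, against the Hodge–Riemann inequality
`σ̄ ∪ σ ≠ 0` (`IsK3Surface.cupProduct_conjClass_self_ne_zero`). Any proof must use `re (x̄.x) > 0`
as a genuine positivity. [cite: Huybrechts2016K3, Ch. 6 Prop. 1.2 (ii)] -/
theorem k3PeriodSurjective_false_without_positivity' :
    ¬ ∀ x : K3Index → ℂ, x ≠ 0 → k3Form x x = 0 → PosVec[x] → Realised[x] := by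
  intro h
  obtain ⟨S, hS, φ, p, -, -, hint, hcup, h20, -⟩ :=
    h perE₁ perE₁_ne_zero perE₁_isotropic ⟨latE₃F₃, latE₃F₃_orth_perE₁, latE₃F₃_pos⟩
  have hσ0 : φ.symm perE₁ ≠ 0 := symm_ne_zero perE₁_ne_zero
  have HR := IsK3Surface.cupProduct_conjClass_self_ne_zero (S := S) hS h20 hσ0
  have hreal : conjClass (Motives.ComplexPoints S) (2 * 1) (φ.symm perE₁) = φ.symm perE₁ := by
    refine IsIntegralClass.isRationalClass ?_ |>.conjClass_eq
    rw [perE₁_eq_intCast]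
    exact isIntegralClass_symm_intCast hint latE₁
  rw [hreal, cup_symm_symm hcup, perE₁_isotropic, zero_smul] at HR
  exact HR rfl

/-- **Isotropy is load-bearing**: the crux WITHOUT `(x.x) = 0` is false — at `x = e₁ + f₁`
(`(x̄.x) = (x.x) = 2 > 0`, `v = e₃ + f₃`) the class `σ = φ⁻¹ x` would be of type `(2,0)` with
`σ ∪ σ = 2p`, while `σ ∪ σ = 0` for `(2,0)`-classes of a surface (`IsK3Surface.cupProduct_twoZero_self`:
type `(4,0)`), forcing `p = 0`, i.e. `∪ ≡ 0` on `H² × H²`, against Hodge–Riemann `σ̄ ∪ σ ≠ 0`.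
[cite: Huybrechts2016K3, Ch. 6 Prop. 1.2 (i), (ii)] [cite: VoisinHodgeI2002, Lemma 7.30] -/
theorem k3PeriodSurjective_false_without_isotropy :
    ¬ ∀ x : K3Index → ℂ, 0 < (k3Form (star x) x).re → PosVec[x] → Realised[x] := by
  intro h
  obtain ⟨S, hS, φ, p, -, -, -, hcup, h20, -⟩ :=
    h perE₁F₁ perE₁F₁_pos ⟨latE₃F₃, latE₃F₃_orth_perE₁F₁, latE₃F₃_pos⟩
  have hσ0 : φ.symm perE₁F₁ ≠ 0 := symm_ne_zero perE₁F₁_ne_zero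
  have h0 := IsK3Surface.cupProduct_twoZero_self hodgePQ_independent_of_hodgeModel_holds
    (fun E _ _ _ => Literature.NumberTheory.Transcendental.exists_deRhamIsoFamily_holds (E := E))
    (S := S) hS h20
  rw [cup_symm_symm hcup, perE₁F₁_sq, smul_eq_zero] at h0
  have hp0 : p = 0 := h0.resolve_left two_ne_zero
  have HR := IsK3Surface.cupProduct_conjClass_self_ne_zero (S := S) hS h20 hσ0
  rw [hcup, hp0, smul_zero] at HR
  exact HR rfl

end Summit.HodgeConjecture.HodgeConjecture.Theorems.K3PeriodSurjective.Negative

end
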